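import Literature.MathematicalPhysics.QuantumFieldTheory.Balaban1983to89.B12FaddeevPopov016

/-!
# `Balaban1983to89.B12RTGaugeInvariance254` — [Balaban1987RG1] p. 254 «t(V,U) is a gauge invariant kernel … If ρ is
a gauge invariant function, then Tρ is gauge invariant also» and p. 265 «The gauge covariance of the averages implies
that the δ-functions in (2.1) are invariant under the gauge transformations V → V^v …» — PROVED, in the kernel form
(0.13) and in the cell's push-forward form of the renormalization transformations

HONEST FRAMING (cell `lit-balaban`, verbatim): statement-level skeleton of published theorems with citation tags;
proofs where landed; nothing here is a claim about the Yang–Mills mass gap.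

CITATION HEADER.  T. Bałaban, *Renormalization group approach to lattice gauge field theories. I. Generation of
effective actions in a small field approximation and a coupling constant renormalization in four dimensions*,
Commun. Math. Phys. **109** (1987) 249–301, doi:10.1007/bf01215223 [Balaban1987RG1] (cell paper B12; held text
`paper:balaban1987-cmp109-rg-i-small-field`, journal page = PDF page + 248; pp. 254–255 [PDF 6–7], p. 263 [PDF 15],
p. 265 [PDF 17] re-read this generation from the held text).  Unit `lit-balaban-r09` gen 6 (display owner of
CMP 109), SKELETON rows `B12.Eq0.13` (the two sentences after (0.13)), `B12.Eq0.17`/`B12.Eq0.19` (the gauge-fixing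
term of the small-field transformations), `B12.Eq2.1` (the gauge clause of p. 265).

WHAT IS PRINTED (verbatim).  p. 254: *«Now we consider renormalization transformations, which have the general form
(Tρ)(V) = ∫dU t(V,U)ρ(U). (0.13)  Here U, V are gauge field configurations on the lattices T, T⁽¹⁾ correspondingly,
and t(V,U) is a gauge invariant kernel, for example see the definitions in [9, 12]. If ρ is a gauge invariant
function, then Tρ is gauge invariant also. […] The kernel t(V,U) introduces connections between fields U and V, like
the equalities Ū = V in the definitions of [9, 16], or more generally |Ū − V| < ε₀ on bonds of T⁽¹⁾. Even with these
restrictions the underintegral expression in (0.13) is still invariant with respect to the gauge transformations u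
satisfying u(y) = 1 for y ∈ T⁽¹⁾.»*  p. 255: *«(Tρ)(V) = ∫dU t(V,U) Π_{y∈T⁽¹⁾} Π_{x∈B(y),x≠y} (1/z) exp[−(1/α)[1 −
Re tr U(y,x)]] χ({|U(y,x) − 1| < ε₀}) ρ(U). (0.16)»* and (0.17) *«A₁(V) = (T₀A)(V) = log N₀⁻¹ ∫dU Π_{c⊂T⁽¹⁾}
δ(Ū(c)V⁻¹(c)) χ₀ exp{−(1/g₀²) Σ_{y∈T⁽¹⁾} Σ_{x∈B(y),x≠y} [1 − Re tr U(y,x)] − (1/g₀²) A(U)}»*.  p. 263 [PDF 15]: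
*«These assumptions imply that the action A_k(U) defined on the space U_k(ε₀) […] is gauge invariant with respect to
all G-valued transformations.»*  p. 265 [PDF 17], after (2.1): *«The gauge covariance of the averages implies that
the δ-functions in (2.1) are invariant under the gauge transformations V → V^v, […], because Ū(U) is […] under the
transformations U → R(u)U, u ∈ G.»* (the bracketed places are illegible in the held text layer; the mechanism — gauge
covariance of the averages `Ū`, (0.5)–(0.6)/(0.11) — is the one formalized below).  Inside quotation marks `[…]`
marks an omission by the author of this file.

DICTIONARY print → Lean (over the cell vocabulary `Setup`: tori `Site P j`, `GaugeField`, `GaugeTransf`,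
`GaugeField.gaugeAct` (`U^u(b) = u(b₋)U(b)u(b₊)⁻¹`), `GaugeField.GaugeInvariant`, `Averaging` (the average `Ū` with
its printed covariance `avg (U^u) = (avg U)^{u∘emb}`), `ContourData.holTo` (the variables `U(y,x)` of (0.11) with
their covariance), `gaugeFixFn` (the gauge-fixing term `Σ_y Σ_{x∈B(y),x≠y}[1 − Re tr U(y,x)]` of (0.17)),
`expGaugeFixWeight`, `fieldMeasure` (`dU`), `IsRT`/`RTOpI` (the push-forward reading of `(Tρ)(V) = ∫dU δ(ŪV⁻¹)…ρ(U)`,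
DIVERGENCE F7 of the cell `pub-balaban`), `SmallFieldStepOp`/`SmallFieldStepI` ((0.17)/(0.19)); and over
`B12FaddeevPopov016`: `KernelRT`/`KernelRT.T` ((0.13) in kernel form), `FineGauge`, `KernelRT.FineInvariant`,
`FineGaugeInvariant`, `fpIntegrand`/`fpWeight` (the (0.16) weight), `integral_comp_gaugeAct` (`dU` is gauge invariant)).
* «the gauge transformations V → V^v» of the COARSE field, induced from a fine `u`: print's `u ↦ (y ↦ u(y))`, in Lean
  `fun y => u (emb y)` (as in `Averaging.covariant`); conversely a coarse `v` is realised by the BLOCK-CONSTANT fine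
  transformation `liftTransf v = v ∘ blockOf` (`liftTransf_emb`: it restricts back to `v`).
* «t(V,U) is a gauge invariant kernel» ↦ `KernelGaugeInvariant k : ∀ u V U, t(V^{u∘emb}, U^u) = t(V,U)` (joint
  invariance; its residual form for `u = 1` on `T⁽¹⁾` is the tree's `KernelRT.FineInvariant`).
* «ρ is a gauge invariant function» ↦ `GaugeField.GaugeInvariant ρ`; the proofs use only invariance under the
  block-constant lifts, `LiftInvariant ρ` (implied, `liftInvariant_of_gaugeInvariant`).

WHAT IS PROVED (kernel-checked, no `sorry`, standard axioms; definitions with bodies: `invTransf`, `liftTransf`,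
`KernelGaugeInvariant`, `LiftInvariant`; everything else theorems).
* §1 gauge-action algebra: `gaugeAct_one'`, `gaugeAct_inv_gaugeAct`, `gaugeAct_gaugeAct_inv`, `liftTransf_emb`,
  `liftTransf_apply_of_mem_block`, `avg_gaugeAct_liftTransf` (`Ū(U^{v∘blockOf}) = (ŪU)^v`).
* §2 KERNEL FORM (0.13): `fineInvariant_of_kernelGaugeInvariant` — **p. 254 «Even with these restrictions the
  underintegral expression in (0.13) is still invariant with respect to the gauge transformations u satisfying
  u(y) = 1 for y ∈ T⁽¹⁾»** (for the kernel; `integrand_fineInvariant` for the whole integrand `t(V,U)ρ(U)`);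
  `kernelRT_gaugeInvariant` — **p. 254 «If ρ is a gauge invariant function, then Tρ is gauge invariant also»**,
  POINTWISE: `(Tρ)(V^v) = (Tρ)(V)` for every coarse `v`, by the change of variables `U → U^{v∘blockOf}` in `dU`
  (`B12FaddeevPopov016.integral_comp_gaugeAct`) and the joint invariance of `t`.
* §3 PUSH-FORWARD FORM (`Setup.IsRT`): `measurable_gaugeAct`, `measurePreserving_gaugeAct` (`dV` is gauge invariant);
  `isRT_comp_gaugeAct` — if `ρ′` is a renormalization image of a lift-invariant `ρ` for a covariant averaging, then so
  is `V ↦ ρ′(V^v)` (Haar invariance on both lattices + `Averaging.covariant`); `ae_eq_of_isRT` — two INTEGRABLE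
  renormalization images of the same density agree `dV`-a.e.; hence `rtOpI_gaugeInvariant_ae` — **the p. 254 sentence
  in the push-forward reading**: for `T : RTOpI`, `ρ` integrable and lift-invariant with `Tρ` integrable,
  `(Tρ)(V^v) = (Tρ)(V)` for `dV`-a.e. `V` (a.e. only: the push-forward reading determines `Tρ` only a.e.).
* §4 THE PRINTED GAUGE-FIXING TERM: `holTo_gaugeAct_liftTransf` (`U^{v∘blockOf}(y,x) = v(y)U(y,x)v(y)⁻¹` for
  `x ∈ B(y)` — the covariance behind p. 265's sentence), `fpIntegrand_conj`, and the invariance under block-constant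
  transformations of `gaugeFixFn` ((0.17) `G(Y,U)`), `expGaugeFixWeight` and `fpWeight` ((0.16)) —
  `gaugeFixFn_gaugeAct_liftTransf`, `expGaugeFixWeight_gaugeAct_liftTransf`, `fpWeight_gaugeAct_liftTransf` — by
  `Re tr (hgh⁻¹) = Re tr g`, `|hgh⁻¹ − 1| = |g − 1|` (`GaugeGroup.reTr_conj`/`dist1_conj`).  (The gauge-fixing term
  is NOT invariant under general fine `u` — that is why (0.15)/(0.16) fix the residual gauge — but it is under the
  lifts, which is what the coarse invariance needs.)
* §5 ASSEMBLY for the small-field transformations (0.17)/(0.19)/(2.1): `liftInvariant_sfDensity` (the fine density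
  `χ·exp[−GF/g² + A]` is lift-invariant when `χ`, `GF`, `A` are); `smallFieldStep_gaugeInvariant_ae` — **p. 265 /
  p. 263: the new action is gauge invariant**, `A_{k+1}(V^v) = A_{k+1}(V)` for `dV`-a.e. `V`, for every step
  `SmallFieldStepI T χ GF g_k A_k A_{k+1}` over an `RTOpI` with lift-invariant `χ`, `GF`, `A_k` (integrability side
  conditions explicit); `smallFieldStep_gaugeInvariant_kernel` — the same POINTWISE for a kernel-form `T = KernelRT.T k`
  with a gauge invariant kernel.  For the printed data: `GF = gaugeFixFn cd univ` is lift-invariant by §4; the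
  plaquette cutoff `χ₀ = Setup.chiSmall` and the Wilson action `A` are invariant under ALL gauge transformations by the
  tree's `T4ReTrLipUnitary.plaqSmallOn_gaugeAct_iff` / `T4WilsonGaugeFlatDirection.wilsonAction_gaugeAct` (not
  imported here; `liftInvariant_of_gaugeInvariant` converts).

WHAT IS NOT PROVED HERE (and not claimed): existence of renormalization images (`AveragingRT.rtOpIOfCompatible` is
the tree's construction); integrability of the printed densities (hypotheses `hint`, `hint'`); anything about the
complex (`Gᶜ`-valued) gauge transformations of (1.10)/(1.19); the Euclidean clause (2.17)–(2.18) (tree: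
`B12EuclTransf218`, `B12GaugeFixInvariance269`); the sentence p. 255 «configurations U from this region satisfy
|U − U₀| < O(1)ε₀».  Pre-existing decls at the same loci, imported or named, never re-declared: `Setup.IsRT`/`RTOp`/
`RTOpI`/`SmallFieldStep*` ((0.13)/(0.19) push-forward), `B12FaddeevPopov016.*` ((0.13)–(0.16) kernel form),
`AveragingRT.*` (inhabited RT), `B14Eq16FaddeevPopov.gaugeAct_emb_of_fineGauge` (the `u = 1`-on-centres case),
`B10Eq26MeasureInv` (the abstract «joint invariance + invariant measure ⇒ invariant integral» mechanism of B10 (26)).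
-/

namespace Literature.MathematicalPhysics.QuantumFieldTheory.Balaban1983to89.B12RTGaugeInvariance254

open _root_.MeasureTheory
open Literature.MathematicalPhysics.QuantumFieldTheory.Balaban1983to89

/-! ## 1. Gauge-action algebra and the block-constant lift of a coarse gauge transformation -/

section Algebra

variable {P : Params} {j : ℕ} {G : Type*} [GaugeGroup G]

/-- The pointwise inverse `u⁻¹(x) = u(x)⁻¹` of a gauge transformation. [cite: Balaban1987RG1, (1.10) p.262] -/
def invTransf (u : GaugeTransf P j G) : GaugeTransf P j G := fun x => (u x)⁻¹

/-- `U^1 = U`. [cite: Balaban1987RG1, (1.10) p.262] -/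
theorem gaugeAct_one' (U : GaugeField P j G) : GaugeField.gaugeAct (fun _ => (1 : G)) U = U := by
  funext b; simp [GaugeField.gaugeAct]

/-- `(U^u)^{u⁻¹} = U`. [cite: Balaban1987RG1, (1.10) p.262] -/
theorem gaugeAct_inv_gaugeAct (u : GaugeTransf P j G) (U : GaugeField P j G) :
    GaugeField.gaugeAct (invTransf u) (GaugeField.gaugeAct u U) = U := by
  funext b; simp only [GaugeField.gaugeAct, invTransf]; group

/-- `(U^{u⁻¹})^u = U`. [cite: Balaban1987RG1, (1.10) p.262] -/
theorem gaugeAct_gaugeAct_inv (u : GaugeTransf P j G) (U : GaugeField P j G) :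
    GaugeField.gaugeAct u (GaugeField.gaugeAct (invTransf u) U) = U := by
  funext b; simp only [GaugeField.gaugeAct, invTransf]; group

/-- The BLOCK-CONSTANT fine gauge transformation `v ∘ blockOf` realising a coarse gauge transformation `v` of
`T^{(j+1)}` on `T^{(j)}` (p. 265: the coarse transformations «V → V^v» induced through the covariance of the
averages). [cite: Balaban1987RG1, (2.1) p.265] -/
def liftTransf (v : GaugeTransf P (j+1) G) : GaugeTransf P j G := fun x => v (blockOf x)

omit [GaugeGroup G] in
/-- On the block `B(y)` the lift is the constant `v(y)`. [cite: Balaban1987RG1, (2.1) p.265] -/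
theorem liftTransf_apply_of_mem_block (v : GaugeTransf P (j+1) G) {y : Site P (j+1)} {x : Site P j}
    (hx : x ∈ block y) : liftTransf v x = v y := by
  have hxy : blockOf x = y := by simpa [block] using hx
  simp [liftTransf, hxy]

omit [GaugeGroup G] in
/-- The lift restricts back to `v` at the block centres (standing range `j + 1 ≤ m + K`, where `blockOf ∘ emb = id`).
[cite: Balaban1987RG1, (2.1) p.265] -/
theorem liftTransf_emb (hj : j + 1 ≤ P.m + P.K) (v : GaugeTransf P (j+1) G) (y : Site P (j+1)) :
    liftTransf v (emb y) = v y := by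
  simp [liftTransf, Site.blockOf_emb hj y]

omit [GaugeGroup G] in
/-- `(v ∘ blockOf) ∘ emb = v`. [cite: Balaban1987RG1, (2.1) p.265] -/
theorem liftTransf_comp_emb (hj : j + 1 ≤ P.m + P.K) (v : GaugeTransf P (j+1) G) :
    (fun y => liftTransf v (emb y)) = v :=
  funext (liftTransf_emb hj v)

/-- Inversion commutes with the lift (definitional). [cite: Balaban1987RG1, (2.1) p.265] -/
theorem invTransf_liftTransf (v : GaugeTransf P (j+1) G) : invTransf (liftTransf v) = liftTransf (invTransf v) := rfl

/-- **The covariance behind p. 265's sentence**: for a covariant averaging, `Ū(U^{v∘blockOf}) = (ŪU)^v`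
(`Setup.Averaging.covariant`, B12 (0.6)/(0.11)). [cite: Balaban1987RG1, (0.6) p.253] -/
theorem avg_gaugeAct_liftTransf (hj : j + 1 ≤ P.m + P.K) (av : Averaging P j G) (v : GaugeTransf P (j+1) G)
    (U : GaugeField P j G) :
    av.avg (GaugeField.gaugeAct (liftTransf v) U) = GaugeField.gaugeAct v (av.avg U) := by
  rw [av.covariant hj, liftTransf_comp_emb hj]

/-- Invariance of a fine density under the block-constant lifts of all coarse gauge transformations — the part of
«ρ is a gauge invariant function» that the coarse invariance of `Tρ` uses. [cite: Balaban1987RG1, (0.13) p.254] -/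
def LiftInvariant (ρ : GaugeField P j G → ℝ) : Prop :=
  ∀ (v : GaugeTransf P (j+1) G) (U : GaugeField P j G), ρ (GaugeField.gaugeAct (liftTransf v) U) = ρ U

/-- A gauge invariant density is lift-invariant. [cite: Balaban1987RG1, (0.13) p.254] -/
theorem liftInvariant_of_gaugeInvariant {ρ : GaugeField P j G → ℝ} (h : GaugeField.GaugeInvariant ρ) :
    LiftInvariant ρ :=
  fun v U => h (liftTransf v) U

end Algebra

/-! ## 2. Kernel form (0.13): gauge invariant kernel ⇒ residual invariance, and `Tρ` gauge invariant -/

section Kernel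

variable {P : Params} {j : ℕ} {G : Type*} [GaugeGroup G] [MeasurableSpace G] [HaarData G]

/-- «t(V,U) is a gauge invariant kernel» (p. 254), as JOINT invariance: `t(V^{u∘emb}, U^u) = t(V,U)` for every gauge
transformation `u` of the fine lattice, the coarse field moving with the induced transformation `y ↦ u(y)`.
[cite: Balaban1987RG1, (0.13) p.254] -/
def KernelGaugeInvariant (k : B12FaddeevPopov016.KernelRT P j G) : Prop :=
  ∀ (u : GaugeTransf P j G) (V : GaugeField P (j+1) G) (U : GaugeField P j G),
    k.t (GaugeField.gaugeAct (fun y => u (emb y)) V) (GaugeField.gaugeAct u U) = k.t V U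

omit [MeasurableSpace G] [HaarData G] in
/-- **p. 254: «Even with these restrictions the underintegral expression in (0.13) is still invariant with respect to
the gauge transformations u satisfying u(y) = 1 for y ∈ T⁽¹⁾»** — for the kernel: a gauge invariant kernel is
invariant under the residual (fine) gauge transformations, `t(V, U^u) = t(V,U)` for `u = 1` on `T⁽¹⁾`
(the tree's `KernelRT.FineInvariant`, the hypothesis of the Faddeev–Popov theorem `fp016_of_fineInvariant`).
[cite: Balaban1987RG1, (0.13) p.254] -/
theorem fineInvariant_of_kernelGaugeInvariant {k : B12FaddeevPopov016.KernelRT P j G} (hk : KernelGaugeInvariant k) :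
    k.FineInvariant := by
  intro u hu V U
  have h := hk u V U
  have h1 : (fun y => u (emb y)) = fun _ => (1 : G) := funext hu
  rwa [h1, gaugeAct_one'] at h

omit [MeasurableSpace G] [HaarData G] in
/-- … and for the whole underintegral expression `t(V,U)ρ(U)` with `ρ` gauge invariant. [cite: Balaban1987RG1, (0.13) p.254] -/
theorem integrand_fineInvariant {k : B12FaddeevPopov016.KernelRT P j G} (hk : KernelGaugeInvariant k) {ρ : Density P j G}
    (hρ : GaugeField.GaugeInvariant ρ) (V : GaugeField P (j+1) G) :
    B12FaddeevPopov016.FineGaugeInvariant (fun U => k.t V U * ρ U) := by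
  intro u hu U
  simp only
  rw [fineInvariant_of_kernelGaugeInvariant hk u hu V U, hρ u U]

variable [MeasurableMul₂ G]

/-- **p. 254: «If ρ is a gauge invariant function, then Tρ is gauge invariant also»** — KERNEL FORM, POINTWISE:
for a gauge invariant kernel `t` and a density `ρ` invariant under the block-constant transformations (in particular
a gauge invariant `ρ`), `(Tρ)(V^v) = ∫dU t(V^v,U)ρ(U) = ∫dU t(V^v,U^{v∘blockOf})ρ(U^{v∘blockOf}) = ∫dU t(V,U)ρ(U)
= (Tρ)(V)`, the middle step being the gauge invariance of `dU`. [cite: Balaban1987RG1, (0.13) p.254] -/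
theorem kernelRT_gaugeAct_of_liftInvariant (hj : j + 1 ≤ P.m + P.K) {k : B12FaddeevPopov016.KernelRT P j G}
    (hk : KernelGaugeInvariant k) {ρ : Density P j G} (hρ : LiftInvariant ρ) (v : GaugeTransf P (j+1) G)
    (V : GaugeField P (j+1) G) :
    k.T ρ (GaugeField.gaugeAct v V) = k.T ρ V := by
  unfold B12FaddeevPopov016.KernelRT.T
  calc ∫ U, k.t (GaugeField.gaugeAct v V) U * ρ U ∂(fieldMeasure P j G)
      = ∫ U, k.t (GaugeField.gaugeAct v V) (GaugeField.gaugeAct (liftTransf v) U) *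
          ρ (GaugeField.gaugeAct (liftTransf v) U) ∂(fieldMeasure P j G) :=
        (B12FaddeevPopov016.integral_comp_gaugeAct (liftTransf v) (fun U => k.t (GaugeField.gaugeAct v V) U * ρ U)).symm
    _ = ∫ U, k.t V U * ρ U ∂(fieldMeasure P j G) := by
        refine integral_congr_ae (Filter.Eventually.of_forall fun U => ?_)
        have h := hk (liftTransf v) V U
        rw [liftTransf_comp_emb hj] at h
        simp only
        rw [h, hρ v U]

/-- **p. 254: «If ρ is a gauge invariant function, then Tρ is gauge invariant also»** (kernel form, as stated).
[cite: Balaban1987RG1, (0.13) p.254] -/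
theorem kernelRT_gaugeInvariant (hj : j + 1 ≤ P.m + P.K) {k : B12FaddeevPopov016.KernelRT P j G} (hk : KernelGaugeInvariant k)
    {ρ : Density P j G} (hρ : GaugeField.GaugeInvariant ρ) : GaugeField.GaugeInvariant (k.T ρ) :=
  fun v V => kernelRT_gaugeAct_of_liftInvariant hj hk (liftInvariant_of_gaugeInvariant hρ) v V

end Kernel

/-! ## 3. Push-forward form (`Setup.IsRT`): the p. 254 sentence for the cell's renormalization transformations -/

section PushForward

variable {P : Params} {j : ℕ} {G : Type*} [GaugeGroup G] [MeasurableSpace G] [HaarData G] [MeasurableMul₂ G]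

omit [HaarData G] in
/-- A gauge transformation acts measurably on gauge fields (bondwise multiplication by constants).
[cite: Balaban1985Averaging, (10) p.19] -/
theorem measurable_gaugeAct (u : GaugeTransf P j G) :
    Measurable (GaugeField.gaugeAct u : GaugeField P j G → GaugeField P j G) := by
  refine measurable_pi_lambda _ fun b => ?_
  have hb : Measurable fun U : GaugeField P j G => U b := measurable_pi_apply b
  exact (hb.const_mul (u b.src)).mul_const ((u b.tgt)⁻¹)

/-- `dU` is gauge invariant: `U ↦ U^u` preserves the product Haar measure (left and right invariance of Haar,
bondwise; cf. `B12FaddeevPopov016.integral_comp_gaugeAct`). [cite: Balaban1985Averaging, (10) p.19] -/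
theorem measurePreserving_gaugeAct (u : GaugeTransf P j G) :
    MeasurePreserving (GaugeField.gaugeAct u) (fieldMeasure P j G) (fieldMeasure P j G) := by
  have h := (AveragingRT.measurePreserving_mulRight (P := P) (j := j) (G := G) (fun b => (u b.tgt)⁻¹)).comp
    (AveragingRT.measurePreserving_mulLeft (P := P) (j := j) (G := G) (fun b => u b.src))
  have hfun : (GaugeField.gaugeAct u : GaugeField P j G → GaugeField P j G) =
      (fun (U : GaugeField P j G) (b : PBond P j) => U b * (u b.tgt)⁻¹) ∘
        (fun (U : GaugeField P j G) (b : PBond P j) => u b.src * U b) := by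
    funext U b; rfl
  rw [hfun]
  exact h

/-- An integrable density stays integrable after a gauge transformation of its argument. [cite: Balaban1985Averaging, (10) p.19] -/
theorem integrable_comp_gaugeAct {ρ : Density P j G} (hρ : Integrable ρ (fieldMeasure P j G))
    (u : GaugeTransf P j G) :
    Integrable (fun U => ρ (GaugeField.gaugeAct u U)) (fieldMeasure P j G) :=
  (measurePreserving_gaugeAct u).integrable_comp_of_integrable hρ

/-- **KEY STEP of the push-forward reading.**  If `ρ′` is a renormalization image of `ρ` (`Setup.IsRT`: `∫dV ρ′(V)f(V)
= ∫dU ρ(U)f(ŪU)` for bounded measurable `f`) for a COVARIANT averaging, and `ρ` is invariant under the block-constant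
gauge transformations, then `V ↦ ρ′(V^v)` is a renormalization image of `ρ` too: test against `f`, move `v` onto
`f` by the gauge invariance of `dV`, use `IsRT`, pull `v⁻¹` through the average by covariance (`(ŪU)^{v⁻¹} =
Ū(U^{v⁻¹∘blockOf})`), and remove it by the gauge invariance of `dU` and of `ρ`.  This is p. 265's «The gauge
covariance of the averages implies that the δ-functions in (2.1) are invariant under the gauge transformations
V → V^v, …» in the cell's δ-free reading. [cite: Balaban1987RG1, (2.1) p.265] -/
theorem isRT_comp_gaugeAct (hj : j + 1 ≤ P.m + P.K) (av : Averaging P j G) {ρ : Density P j G}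
    {ρ' : Density P (j+1) G} (h : IsRT av.avg ρ ρ') (hρ : LiftInvariant ρ) (v : GaugeTransf P (j+1) G) :
    IsRT av.avg ρ (fun V => ρ' (GaugeField.gaugeAct v V)) := by
  intro f hf hbd
  obtain ⟨C, hC⟩ := hbd
  have hf' : Measurable (fun V : GaugeField P (j+1) G => f (GaugeField.gaugeAct (invTransf v) V)) :=
    hf.comp (measurable_gaugeAct _)
  have hbd' : ∃ C : ℝ, ∀ V : GaugeField P (j+1) G, |f (GaugeField.gaugeAct (invTransf v) V)| ≤ C :=
    ⟨C, fun V => hC _⟩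
  have key := h _ hf' hbd'
  calc ∫ V, ρ' (GaugeField.gaugeAct v V) * f V ∂(fieldMeasure P (j+1) G)
      = ∫ V, ρ' (GaugeField.gaugeAct v V) *
          f (GaugeField.gaugeAct (invTransf v) (GaugeField.gaugeAct v V)) ∂(fieldMeasure P (j+1) G) := by
        simp_rw [gaugeAct_inv_gaugeAct]
    _ = ∫ V, ρ' V * f (GaugeField.gaugeAct (invTransf v) V) ∂(fieldMeasure P (j+1) G) :=
        B12FaddeevPopov016.integral_comp_gaugeAct v (fun V => ρ' V * f (GaugeField.gaugeAct (invTransf v) V))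
    _ = ∫ U, ρ U * f (GaugeField.gaugeAct (invTransf v) (av.avg U)) ∂(fieldMeasure P j G) := key
    _ = ∫ U, ρ U * f (av.avg (GaugeField.gaugeAct (liftTransf (invTransf v)) U)) ∂(fieldMeasure P j G) := by
        simp_rw [avg_gaugeAct_liftTransf hj av (invTransf v)]
    _ = ∫ U, ρ (GaugeField.gaugeAct (liftTransf v) U) *
          f (av.avg (GaugeField.gaugeAct (liftTransf (invTransf v))
            (GaugeField.gaugeAct (liftTransf v) U))) ∂(fieldMeasure P j G) :=
        (B12FaddeevPopov016.integral_comp_gaugeAct (liftTransf v)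
          (fun U => ρ U * f (av.avg (GaugeField.gaugeAct (liftTransf (invTransf v)) U)))).symm
    _ = ∫ U, ρ U * f (av.avg U) ∂(fieldMeasure P j G) := by
        refine integral_congr_ae (Filter.Eventually.of_forall fun U => ?_)
        simp only
        rw [hρ v U, ← invTransf_liftTransf, gaugeAct_inv_gaugeAct]

omit [MeasurableMul₂ G] in
/-- UNIQUENESS a.e. of renormalization images: two INTEGRABLE densities `ρ₁`, `ρ₂` that are both renormalization
images of the same `ρ` (same averaging) agree `dV`-almost everywhere (test `IsRT` against indicators of measurable
sets).  The push-forward reading fixes `Tρ` exactly up to this ambiguity. [cite: Balaban1987RG1, (0.13) p.254] -/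
theorem ae_eq_of_isRT {avg : GaugeField P j G → GaugeField P (j+1) G} {ρ : Density P j G}
    {ρ₁ ρ₂ : Density P (j+1) G} (h₁ : IsRT avg ρ ρ₁) (h₂ : IsRT avg ρ ρ₂)
    (hi₁ : Integrable ρ₁ (fieldMeasure P (j+1) G)) (hi₂ : Integrable ρ₂ (fieldMeasure P (j+1) G)) :
    ρ₁ =ᵐ[fieldMeasure P (j+1) G] ρ₂ := by
  refine Integrable.ae_eq_of_forall_setIntegral_eq ρ₁ ρ₂ hi₁ hi₂ fun s hs _ => ?_
  have hf : Measurable (s.indicator fun _ : GaugeField P (j+1) G => (1 : ℝ)) := measurable_const.indicator hs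
  have hbd : ∃ C : ℝ, ∀ V, |s.indicator (fun _ : GaugeField P (j+1) G => (1 : ℝ)) V| ≤ C :=
    ⟨1, fun V => by by_cases hV : V ∈ s <;> simp [hV]⟩
  have e₁ := h₁ _ hf hbd
  have e₂ := h₂ _ hf hbd
  have k₁ : s.indicator ρ₁ = fun V => ρ₁ V * s.indicator (fun _ : GaugeField P (j+1) G => (1 : ℝ)) V := by
    funext V; by_cases hV : V ∈ s <;> simp [hV]
  have k₂ : s.indicator ρ₂ = fun V => ρ₂ V * s.indicator (fun _ : GaugeField P (j+1) G => (1 : ℝ)) V := by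
    funext V; by_cases hV : V ∈ s <;> simp [hV]
  rw [← integral_indicator hs, ← integral_indicator hs, k₁, k₂, e₁, e₂]

/-- **p. 254: «If ρ is a gauge invariant function, then Tρ is gauge invariant also»** — PUSH-FORWARD FORM (the
cell's inhabited carrier `Setup.RTOpI`, DIVERGENCE F7/F17): for an integrable density `ρ` invariant under the
block-constant gauge transformations (e.g. gauge invariant) whose image `Tρ` is integrable, `(Tρ)(V^v) = (Tρ)(V)` for
`dV`-almost every `V`, for each coarse gauge transformation `v`.  (Almost everywhere is all the push-forward reading
can give: it determines `Tρ` only a.e.; the kernel form of §2 is pointwise.) [cite: Balaban1987RG1, (0.13) p.254] -/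
theorem rtOpI_gaugeInvariant_ae (hj : j + 1 ≤ P.m + P.K) {av : Averaging P j G} (T : RTOpI P j G av)
    {ρ : Density P j G} (hρi : Integrable ρ (fieldMeasure P j G)) (hρ : LiftInvariant ρ)
    (hT : Integrable (T.T ρ) (fieldMeasure P (j+1) G)) (v : GaugeTransf P (j+1) G) :
    (fun V => T.T ρ (GaugeField.gaugeAct v V)) =ᵐ[fieldMeasure P (j+1) G] T.T ρ :=
  ae_eq_of_isRT (isRT_comp_gaugeAct hj av (T.isRT ρ hρi) hρ v) (T.isRT ρ hρi)
    (integrable_comp_gaugeAct hT v) hT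

end PushForward

/-! ## 4. The printed gauge-fixing term of (0.16)/(0.17) is invariant under the block-constant transformations -/

section GaugeFixing

variable {P : Params} {j : ℕ} {G : Type*} [GaugeGroup G]

/-- **The mechanism of p. 265's sentence for the variables `U(y,x)` of (0.11)**: under the block-constant
transformation `v ∘ blockOf` they are conjugated, `U^{v∘blockOf}(y,x) = v(y)U(y,x)v(y)⁻¹` for `x ∈ B(y)`
(`ContourData.covariant` + `(v ∘ blockOf)(x) = v(y)` on `B(y)` + `blockOf (emb y) = y`). [cite: Balaban1987RG1, (0.11) p.253] -/
theorem holTo_gaugeAct_liftTransf (hj : j + 1 ≤ P.m + P.K) (cd : ContourData P j G) (v : GaugeTransf P (j+1) G)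
    (U : GaugeField P j G) {y : Site P (j+1)} {x : Site P j} (hx : x ∈ block y) :
    cd.holTo (GaugeField.gaugeAct (liftTransf v) U) y x = v y * cd.holTo U y x * (v y)⁻¹ := by
  rw [cd.covariant, liftTransf_emb hj, liftTransf_apply_of_mem_block v hx]

/-- The gauge-fixing term `G(Y,U) = Σ_{y∈Y} Σ_{x∈B(y),x≠y} [1 − Re tr U(y,x)]` of (0.17) is invariant under the
block-constant gauge transformations (`Re tr (hgh⁻¹) = Re tr g`). [cite: Balaban1987RG1, (0.17) p.255] -/
theorem gaugeFixFn_gaugeAct_liftTransf (hj : j + 1 ≤ P.m + P.K) (cd : ContourData P j G)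
    (Y : Finset (Site P (j+1))) (v : GaugeTransf P (j+1) G) (U : GaugeField P j G) :
    gaugeFixFn cd Y (GaugeField.gaugeAct (liftTransf v) U) = gaugeFixFn cd Y U := by
  unfold gaugeFixFn
  refine Finset.sum_congr rfl fun y _ => Finset.sum_congr rfl fun x hx => ?_
  rw [holTo_gaugeAct_liftTransf hj cd v U (Finset.mem_of_mem_erase hx), GaugeGroup.reTr_conj]

/-- … hence so is the exponential gauge-fixing weight `exp[−(1/α)G(T⁽¹⁾,U)]` of (0.14)/(0.17). [cite: Balaban1987RG1, (0.14) p.254] -/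
theorem expGaugeFixWeight_gaugeAct_liftTransf (hj : j + 1 ≤ P.m + P.K) (cd : ContourData P j G) (α : ℝ)
    (v : GaugeTransf P (j+1) G) (U : GaugeField P j G) :
    expGaugeFixWeight cd α (GaugeField.gaugeAct (liftTransf v) U) = expGaugeFixWeight cd α U := by
  unfold expGaugeFixWeight
  rw [gaugeFixFn_gaugeAct_liftTransf hj]

/-- The one-variable factor `exp[−(1/α)[1 − Re tr u]]χ({|u − 1| < ε₀})` of (0.15)/(0.16) is a class function
(`Re tr`, `|· − 1|` are conjugation invariant). [cite: Balaban1987RG1, (0.15) p.254] -/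
theorem fpIntegrand_conj (α ε₀ : ℝ) (g h : G) :
    B12FaddeevPopov016.fpIntegrand α ε₀ (h * g * h⁻¹) = B12FaddeevPopov016.fpIntegrand α ε₀ g := by
  unfold B12FaddeevPopov016.fpIntegrand
  rw [GaugeGroup.reTr_conj]
  simp only [Set.indicator_apply, Set.mem_setOf_eq, GaugeGroup.dist1_conj]

variable [MeasurableSpace G] [HaarData G]

/-- The gauge-fixing weight `Π_y Π_{x∈B(y),x≠y} z⁻¹exp[−(1/α)[1 − Re tr U(y,x)]]χ({|U(y,x)−1| < ε₀})` of (0.16) is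
invariant under the block-constant gauge transformations. [cite: Balaban1987RG1, (0.16) p.255] -/
theorem fpWeight_gaugeAct_liftTransf (hj : j + 1 ≤ P.m + P.K) (cd : ContourData P j G) (α ε₀ : ℝ)
    (v : GaugeTransf P (j+1) G) (U : GaugeField P j G) :
    B12FaddeevPopov016.fpWeight cd α ε₀ (GaugeField.gaugeAct (liftTransf v) U) =
      B12FaddeevPopov016.fpWeight cd α ε₀ U := by
  unfold B12FaddeevPopov016.fpWeight
  refine Finset.prod_congr rfl fun y _ => Finset.prod_congr rfl fun x hx => ?_
  rw [holTo_gaugeAct_liftTransf hj cd v U (Finset.mem_of_mem_erase hx), fpIntegrand_conj]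

end GaugeFixing

/-! ## 5. Assembly: the new action of a small-field transformation (0.17)/(0.19)/(2.1) is gauge invariant -/

section SmallField

variable {P : Params} {j : ℕ} {G : Type*} [GaugeGroup G]

/-- The fine density `χ(U)·exp[−(1/g²)GF(U) + A(U)]` of the small-field step (0.17)/(0.19) (the argument of `T` in
`Setup.SmallFieldStepOp`) is invariant under the block-constant transformations when its three ingredients are.
[cite: Balaban1987RG1, (0.19) p.255] -/
theorem liftInvariant_sfDensity {χ GF A : Density P j G} (hχ : LiftInvariant χ) (hGF : LiftInvariant GF)
    (hA : LiftInvariant A) (gk : ℝ) :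
    LiftInvariant (fun U => χ U * Real.exp (-(1 / gk ^ 2) * GF U + A U)) := by
  intro v U
  simp only
  rw [hχ v U, hGF v U, hA v U]

/-- The printed gauge-fixing term `GF = G(T⁽¹⁾, ·)` of (0.17) qualifies (`§4`). [cite: Balaban1987RG1, (0.17) p.255] -/
theorem liftInvariant_gaugeFixFn (hj : j + 1 ≤ P.m + P.K) (cd : ContourData P j G) (Y : Finset (Site P (j+1))) :
    LiftInvariant (gaugeFixFn cd Y) :=
  fun v U => gaugeFixFn_gaugeAct_liftTransf hj cd Y v U

/-- From an equality `N·e^a = N·e^b` with `N > 0` to `a = b`. [folklore] -/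
private theorem eq_of_mul_exp_eq {N a b : ℝ} (hN : 0 < N) (h : N * Real.exp a = N * Real.exp b) : a = b :=
  Real.exp_injective (mul_left_cancel₀ hN.ne' h)

variable [MeasurableSpace G] [HaarData G] [MeasurableMul₂ G]

/-- **p. 265 / p. 263 «the action … is gauge invariant», push-forward form.**  For a small-field step
`T(χ e^{−GF/g_k² + A_k}) = N_k e^{A_{k+1}}`, `A_{k+1}(1) = 0` (`Setup.SmallFieldStepI` over the inhabited carrier
`RTOpI` of a covariant averaging) with `χ`, `GF`, `A_k` invariant under the block-constant gauge transformations and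
the two printed densities integrable, the new action is gauge invariant: `A_{k+1}(V^v) = A_{k+1}(V)` for `dV`-a.e. `V`,
for every coarse gauge transformation `v`. [cite: Balaban1987RG1, (2.1) p.265] -/
theorem smallFieldStep_gaugeInvariant_ae (hj : j + 1 ≤ P.m + P.K) {av : Averaging P j G} (T : RTOpI P j G av)
    {χ GF A : Density P j G} {gk : ℝ} {A' : Density P (j+1) G} (hstep : SmallFieldStepI T χ GF gk A A')
    (hχ : LiftInvariant χ) (hGF : LiftInvariant GF) (hA : LiftInvariant A)
    (hint : Integrable (fun U => χ U * Real.exp (-(1 / gk ^ 2) * GF U + A U)) (fieldMeasure P j G))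
    (hint' : Integrable (T.T (fun U => χ U * Real.exp (-(1 / gk ^ 2) * GF U + A U))) (fieldMeasure P (j+1) G))
    (v : GaugeTransf P (j+1) G) :
    (fun V => A' (GaugeField.gaugeAct v V)) =ᵐ[fieldMeasure P (j+1) G] A' := by
  unfold SmallFieldStepI SmallFieldStepOp at hstep
  obtain ⟨N, hN, hT, -⟩ := hstep
  have h := rtOpI_gaugeInvariant_ae hj T hint (liftInvariant_sfDensity hχ hGF hA gk) hint' v
  rw [hT] at h
  filter_upwards [h] with V hV
  exact eq_of_mul_exp_eq hN hV

/-- **The same, kernel form, POINTWISE**: for a small-field step in the operator form `Setup.SmallFieldStepOp` with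
`T = ∫dU t(·,U)(…)` (0.13) given by a gauge invariant kernel, the new action satisfies `A_{k+1}(V^v) = A_{k+1}(V)`
for all `V`. [cite: Balaban1987RG1, (2.1) p.265] -/
theorem smallFieldStep_gaugeInvariant_kernel (hj : j + 1 ≤ P.m + P.K) {k : B12FaddeevPopov016.KernelRT P j G}
    (hk : KernelGaugeInvariant k) {χ GF A : Density P j G} {gk : ℝ} {A' : Density P (j+1) G}
    (hstep : SmallFieldStepOp k.T χ GF gk A A') (hχ : LiftInvariant χ) (hGF : LiftInvariant GF)
    (hA : LiftInvariant A) : GaugeField.GaugeInvariant A' := by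
  unfold SmallFieldStepOp at hstep
  obtain ⟨N, hN, hT, -⟩ := hstep
  intro v V
  have h := kernelRT_gaugeAct_of_liftInvariant hj hk (liftInvariant_sfDensity hχ hGF hA gk) v V
  rw [hT] at h
  exact eq_of_mul_exp_eq hN h

end SmallField

end Literature.MathematicalPhysics.QuantumFieldTheory.Balaban1983to89.B12RTGaugeInvariance254
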